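import Summits.Ventures.YMGap.Census.TwistCensusSheets
import Summits.Ventures.LatticeQCDFlow.Scoring.SU2CharacterRowIntegral
import Summits.Ventures.LatticeQCDFlow.Scoring.SU2CharacterExpansion
import HarnessLib

/-!
# Venture YMGap, track (b) census — the flat sheet under the Haar integral: rows merge to Polyakov-line characters

HONEST FRAMING: venture file of the cell `pub-ymgap` (QuantumFields programme), track (b).  Exact `SU(2)` character
calculus inside the product Haar integral of a rectangular `d`-torus (every side `≥ 1`); nothing about root locations,
limits or physics.  File 2 of 3 (`TwistCensusSheets` → this → `TwistCensusGermLaw`): the two-dimensional `SU(2)`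
lattice gauge theory on the flat `Lᵢ × Lⱼ` sheet of `TwistCensusSheets.flatSheet`, run INSIDE the `d`-torus integral
against spectators that do not read the links being integrated.
* (`TwistCensusSheets.sheetLine y b R` = `H_b` for `R = Lᵢ`, the ordered product of the `i`-links of row `b`;
  `sheetPlaqChar` = a sheet plaquette character in its four links; no definitions in this file);
* `integral_mul_prod_sheetRow_open`: `R − 1` face mergings along a row, `∫ χ(αgβ) χ(γg⁻¹) dg = ½ χ(αγβ)`
  (`LatticeQCDFlow.Scoring.integral_pi_su2_merge`; the rectangular-`d`-torus, one-character port of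
  `LatticeQCDFlow.Scoring.integral_mul_prod_strip_su2Character`);
* `integral_mul_prod_sheetRow`: closing the row with the handle identity `∫ χ(αgβg⁻¹) dg = ½ χ(α)χ(β)`
  (`integral_pi_su2_handle`): **a full row integrates to `2^{−Lᵢ} χ(H_b) χ(H_{b+1})`**; `integral_mul_prod_sheetRows`:
  all rows, `2^{−Lᵢ|s|} ∏_{b ∈ s} χ(H_b) χ(H_{b+1})`;
* `integral_mul_lineSq` / `integral_mul_prod_lineSq`: **each Polyakov line integrates its squared character to one**
  (one Haar right-translation of `h(0, b)` + `integral_su2Character_sq`); assembly in `TwistCensusGermLaw`.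

References: A. A. Migdal, Sov. Phys. JETP 42 (1975) 413; J.-M. Drouffe, J.-B. Zuber, Phys. Rept. 102 (1983) 1, §3
(character calculus of two-dimensional lattice gauge theory: gluing plaquettes, closing handles) [folklore].
-/

noncomputable section

open MeasureTheory Finset Real Function
open scoped BigOperators
open Literature.MathematicalPhysics.QuantumLattice
open Literature.MathematicalPhysics.QuantumFieldTheory
open Literature.MathematicalPhysics.QuantumFieldTheory.Tomboulis2007
open Summit.Ventures.LatticeQCDFlow.Exactness
open Summit.Ventures.LatticeQCDFlow.Scoring

namespace Summit.Ventures.YMGap.Census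

variable {d : ℕ} (Ls : Fin d → ℕ) [∀ i, NeZero (Ls i)]

variable {i j : Fin d} (hij : i < j)

omit [∀ i, NeZero (Ls i)] in
/-- An `i`-link is not a `j`-link (plumbing). -/
private theorem ilink_ne_jlink (hij : i < j) (x z : RectTorusSite Ls) : ((x, i) : RectEdge Ls) ≠ (z, j) :=
  fun h => hij.ne (congrArg Prod.snd h)

omit [∀ i, NeZero (Ls i)] in
/-- A sheet plaquette character reads no `j`-link other than its own two (plumbing). -/
theorem sheetPlaqChar_update_jlink (hij : i < j) (y : RectTorusSite Ls) {a a' : ZMod (Ls i)} {b b' : ZMod (Ls j)}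
    (h1 : ¬(a' = a + 1 ∧ b' = b)) (h0 : ¬(a' = a ∧ b' = b)) (V : RectGaugeConfig Ls SU2) (g : SU2) :
    sheetPlaqChar Ls i j y a b (update V (sheetSite Ls i j y a' b', j) g) = sheetPlaqChar Ls i j y a b V := by
  unfold sheetPlaqChar
  rw [update_of_ne (ilink_ne_jlink Ls hij _ _), update_of_ne, update_of_ne (ilink_ne_jlink Ls hij _ _), update_of_ne]
  · exact fun h => h0 (let e := (sheetSite_eq_iff Ls hij y).1 (congrArg Prod.fst h); ⟨e.1.symm, e.2.symm⟩)
  · exact fun h => h1 (let e := (sheetSite_eq_iff Ls hij y).1 (congrArg Prod.fst h); ⟨e.1.symm, e.2.symm⟩)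

omit [∀ i, NeZero (Ls i)] in
/-- In particular it reads no `j`-link of another row (plumbing). -/
theorem sheetPlaqChar_update_jlink_of_ne (hij : i < j) (y : RectTorusSite Ls) (a a' : ZMod (Ls i)) {b b' : ZMod (Ls j)}
    (hb : b' ≠ b) (V : RectGaugeConfig Ls SU2) (g : SU2) :
    sheetPlaqChar Ls i j y a b (update V (sheetSite Ls i j y a' b', j) g) = sheetPlaqChar Ls i j y a b V :=
  sheetPlaqChar_update_jlink Ls hij y (fun e => hb e.2) (fun e => hb e.2) V g

omit [∀ i, NeZero (Ls i)] in
/-- The `i`-lines read no `j`-link (plumbing). -/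
theorem sheetLine_update_jlink (hij : i < j) (y : RectTorusSite Ls) (b : ZMod (Ls j)) (R : ℕ)
    (V : RectGaugeConfig Ls SU2) (z : RectTorusSite Ls) (g : SU2) :
    sheetLine Ls i j y b R (update V (z, j) g) = sheetLine Ls i j y b R V := by
  unfold sheetLine
  exact congrArg List.prod (List.map_congr_left fun a _ => update_of_ne (ilink_ne_jlink Ls hij _ _) _ _)

omit [∀ i, NeZero (Ls i)] in
/-- The `i`-line of row `b` reads no `i`-link of another row (plumbing). -/
theorem sheetLine_update_ilink_of_ne (hij : i < j) (y : RectTorusSite Ls) {b b' : ZMod (Ls j)} (hb : b' ≠ b) (R : ℕ)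
    (V : RectGaugeConfig Ls SU2) (a' : ZMod (Ls i)) (g : SU2) :
    sheetLine Ls i j y b R (update V (sheetSite Ls i j y a' b', i) g) = sheetLine Ls i j y b R V := by
  unfold sheetLine
  refine congrArg List.prod (List.map_congr_left fun a _ => update_of_ne ?_ _ _)
  exact fun h => hb ((sheetSite_eq_iff Ls hij y).1 (congrArg Prod.fst h)).2.symm

omit [∀ i, NeZero (Ls i)] in
/-- Growing the line by one link (plumbing). -/
theorem sheetLine_succ (y : RectTorusSite Ls) (b : ZMod (Ls j)) (R : ℕ) (V : RectGaugeConfig Ls SU2) :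
    sheetLine Ls i j y b (R + 1) V = sheetLine Ls i j y b R V * V (sheetSite Ls i j y (R : ZMod (Ls i)) b, i) := by
  simp [sheetLine, List.range_succ, List.map_append, List.prod_append]

omit [∀ i, NeZero (Ls i)] in
/-- The line as its first link times the rest (plumbing). -/
theorem sheetLine_succ_eq_head_mul (y : RectTorusSite Ls) (b : ZMod (Ls j)) (R : ℕ) (V : RectGaugeConfig Ls SU2) :
    sheetLine Ls i j y b (R + 1) V = V (sheetSite Ls i j y 0 b, i) *
      ((List.range R).map fun a : ℕ => V (sheetSite Ls i j y ((a + 1 : ℕ) : ZMod (Ls i)) b, i)).prod := by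
  simp only [sheetLine, List.range_succ_eq_map, List.map_cons, List.map_map, List.prod_cons, Nat.cast_zero]
  rfl

omit [∀ i, NeZero (Ls i)] in
/-- The lines are continuous in the configuration (plumbing). -/
theorem continuous_sheetLine (y : RectTorusSite Ls) (b : ZMod (Ls j)) (R : ℕ) : Continuous (sheetLine Ls i j y b R) :=
  continuous_list_prod _ fun _ _ => continuous_apply _

omit [∀ i, NeZero (Ls i)] in
/-- Line characters are continuous (plumbing). -/
theorem continuous_su2Char_sheetLine (y : RectTorusSite Ls) (b : ZMod (Ls j)) (R : ℕ) :
    Continuous fun V => su2Char 1 (sheetLine Ls i j y b R V) :=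
  continuous_su2Character_comp 1 (continuous_sheetLine Ls y b R)

omit [∀ i, NeZero (Ls i)] in
/-- Sheet plaquette characters are continuous (plumbing). -/
theorem continuous_sheetPlaqChar (y : RectTorusSite Ls) (a : ZMod (Ls i)) (b : ZMod (Ls j)) :
    Continuous (sheetPlaqChar Ls i j y a b) :=
  continuous_su2Character_comp 1 (by fun_prop)

omit [∀ i, NeZero (Ls i)] in
/-- `χ(g⁻¹) = χ(g)` (plumbing, `su2a0_inv`). -/
private theorem su2Char_of_inv (n : ℕ) (g : SU2) : su2Char n g⁻¹ = su2Char n g := by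
  show (Polynomial.Chebyshev.U ℝ n).eval (su2a0 g⁻¹) = (Polynomial.Chebyshev.U ℝ n).eval (su2a0 g)
  rw [su2a0_inv]

/-- Distinct naturals `0 < a < c ≤ n` have distinct residues mod `n`, also when `c = n` (plumbing). -/
private theorem natCast_zmod_ne_of_pos_lt_le {n a c : ℕ} (h0 : 0 < a) (hac : a < c) (hcn : c ≤ n) :
    (a : ZMod n) ≠ (c : ZMod n) := by
  intro e
  have h := (ZMod.natCast_eq_natCast_iff' a c n).1 e
  rw [Nat.mod_eq_of_lt (by omega)] at h
  rcases Nat.lt_or_ge c n with hc | hc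
  · rw [Nat.mod_eq_of_lt hc] at h
    omega
  · obtain rfl : c = n := le_antisymm hcn hc
    rw [Nat.mod_self] at h
    omega

/-- **Merging a row of the sheet** (`1 ≤ R ≤ Lᵢ`): for a continuous spectator `F` not reading the interior `j`-links
`v(a, b)`, `0 < a < R`, of row `b`,
`∫ F · ∏_{a<R} χ(U_{(a,b)}) = 2^{−(R−1)} ∫ F · χ(h(0,b)⋯h(R−1,b) · v(R,b) · (h(0,b+1)⋯h(R−1,b+1))⁻¹ · v(0,b)⁻¹)`
— `R − 1` face mergings `∫ χ(αgβ) χ(γg⁻¹) dg = ½ χ(αγβ)` (`LatticeQCDFlow.Scoring.integral_pi_su2_merge`); the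
rectangular-`d`-torus, one-character port of `LatticeQCDFlow.Scoring.integral_mul_prod_strip_su2Character`. -/
theorem integral_mul_prod_sheetRow_open (hij : i < j) (y : RectTorusSite Ls) (b : ZMod (Ls j)) :
    ∀ (R : ℕ), 1 ≤ R → R ≤ Ls i →
    ∀ (F : RectGaugeConfig Ls SU2 → ℝ), Continuous F →
      (∀ a : ℕ, 0 < a → a < R → ∀ V g, F (update V (sheetSite Ls i j y (a : ZMod (Ls i)) b, j) g) = F V) →
      ∫ V, F V * ∏ a ∈ range R, sheetPlaqChar Ls i j y (a : ZMod (Ls i)) b V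
          ∂(Measure.pi fun _ : RectEdge Ls => haarProbability SU2) =
        ((2 : ℝ) ^ (R - 1))⁻¹ *
          ∫ V, F V * su2Char 1 (sheetLine Ls i j y b R V * V (sheetSite Ls i j y (R : ZMod (Ls i)) b, j) *
              (sheetLine Ls i j y (b + 1) R V)⁻¹ * (V (sheetSite Ls i j y 0 b, j))⁻¹)
            ∂(Measure.pi fun _ : RectEdge Ls => haarProbability SU2) := by
  intro R
  induction R with
  | zero => intro h; omega
  | succ R' ih =>
    intro _ hRL F hFc hF
    rcases Nat.eq_zero_or_pos R' with rfl | hR'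
    · -- one plaquette: nothing to merge
      simp only [zero_add, Nat.sub_self, pow_zero, inv_one, one_mul, Finset.range_one, Finset.prod_singleton,
        sheetLine, List.range_one, List.map_singleton, List.prod_singleton, Nat.cast_zero, Nat.cast_one, sheetPlaqChar]
    · -- merge the plaquette `R'` into the open strip of the first `R'` plaquettes, along `v(R', b)`
      haveI : Fact (1 < Ls i) := ⟨by omega⟩
      have hR'L : R' < Ls i := by omega
      have hc0 : (0 : ZMod (Ls i)) ≠ (R' : ZMod (Ls i)) := by
        rw [← Nat.cast_zero]
        exact natCast_zmod_ne_of_lt (by omega) hR'L (by omega)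
      have hc1 : (R' : ZMod (Ls i)) + 1 ≠ (R' : ZMod (Ls i)) := by
        rw [ne_eq, add_eq_left]
        exact one_ne_zero
      -- Step 1: split off the last plaquette and merge the first `R'` (induction hypothesis, the last one a spectator)
      have hfupd : ∀ a : ℕ, 0 < a → a < R' → ∀ V g,
          sheetPlaqChar Ls i j y (R' : ZMod (Ls i)) b (update V (sheetSite Ls i j y (a : ZMod (Ls i)) b, j) g) =
            sheetPlaqChar Ls i j y (R' : ZMod (Ls i)) b V := by
        intro a ha0 haR V g
        refine sheetPlaqChar_update_jlink Ls hij y (fun e => ?_) (fun e => ?_) V g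
        · rw [← Nat.cast_succ] at e
          exact natCast_zmod_ne_of_pos_lt_le ha0 (by omega) hRL e.1
        · exact natCast_zmod_ne_of_lt (by omega) hR'L (by omega) e.1
      have hsplit : ∀ V : RectGaugeConfig Ls SU2,
          F V * ∏ a ∈ range (R' + 1), sheetPlaqChar Ls i j y (a : ZMod (Ls i)) b V =
            (F V * sheetPlaqChar Ls i j y (R' : ZMod (Ls i)) b V) *
              ∏ a ∈ range R', sheetPlaqChar Ls i j y (a : ZMod (Ls i)) b V := by
        intro V
        rw [Finset.prod_range_succ]
        ring
      simp_rw [hsplit]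
      rw [ih hR' (by omega) (fun V => F V * sheetPlaqChar Ls i j y (R' : ZMod (Ls i)) b V)
        (hFc.mul (continuous_sheetPlaqChar Ls y _ b))
        (fun a ha0 haR V g => by rw [hF a ha0 (by omega), hfupd a ha0 haR])]
      -- Step 2: the merge along `c = v(R', b)`
      have hmerge := integral_pi_su2_merge (ι := RectEdge Ls) (sheetSite Ls i j y (R' : ZMod (Ls i)) b, j)
        (fun V => sheetLine Ls i j y b R' V)
        (fun V => (sheetLine Ls i j y (b + 1) R' V)⁻¹ * (V (sheetSite Ls i j y 0 b, j))⁻¹)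
        (fun V => V (sheetSite Ls i j y (R' : ZMod (Ls i)) b, i) * V (sheetSite Ls i j y ((R' : ZMod (Ls i)) + 1) b, j) *
          (V (sheetSite Ls i j y (R' : ZMod (Ls i)) (b + 1), i))⁻¹)
        F (fun V g => sheetLine_update_jlink Ls hij y b R' V _ g)
        (fun V g => by
          rw [sheetLine_update_jlink Ls hij, update_of_ne]
          exact fun h => hc0 ((sheetSite_eq_iff Ls hij y).1 (congrArg Prod.fst h)).1)
        (fun V g => by
          rw [update_of_ne (ilink_ne_jlink Ls hij _ _), update_of_ne, update_of_ne (ilink_ne_jlink Ls hij _ _)]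
          exact fun h => hc1 ((sheetSite_eq_iff Ls hij y).1 (congrArg Prod.fst h)).1)
        (fun V g => hF R' hR' (lt_add_one R') V g) (continuous_sheetLine Ls y b R')
        (((continuous_sheetLine Ls y (b + 1) R').inv).mul (continuous_apply _).inv) (by fun_prop) hFc 1 1
      rw [if_pos rfl, show ((1 : ℕ) : ℝ) + 1 = 2 by norm_num] at hmerge
      -- the integrand in merge form
      have hpt : ∀ V : RectGaugeConfig Ls SU2,
          F V * sheetPlaqChar Ls i j y (R' : ZMod (Ls i)) b V *
              su2Char 1 (sheetLine Ls i j y b R' V * V (sheetSite Ls i j y (R' : ZMod (Ls i)) b, j) *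
                (sheetLine Ls i j y (b + 1) R' V)⁻¹ * (V (sheetSite Ls i j y 0 b, j))⁻¹) =
            su2Char 1 (sheetLine Ls i j y b R' V * V (sheetSite Ls i j y (R' : ZMod (Ls i)) b, j) *
                ((sheetLine Ls i j y (b + 1) R' V)⁻¹ * (V (sheetSite Ls i j y 0 b, j))⁻¹)) *
              su2Char 1 (V (sheetSite Ls i j y (R' : ZMod (Ls i)) b, i) *
                    V (sheetSite Ls i j y ((R' : ZMod (Ls i)) + 1) b, j) *
                  (V (sheetSite Ls i j y (R' : ZMod (Ls i)) (b + 1), i))⁻¹ *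
                (V (sheetSite Ls i j y (R' : ZMod (Ls i)) b, j))⁻¹) * F V := by
        intro V
        simp only [sheetPlaqChar, mul_assoc]
        ring
      simp_rw [hpt]
      erw [hmerge]
      rw [← mul_assoc, ← mul_inv, show R' + 1 - 1 = (R' - 1) + 1 by omega, pow_succ]
      refine congrArg (HMul.hMul _) (integral_congr_ae (ae_of_all _ fun V => ?_))
      beta_reduce
      rw [mul_comm]
      refine congrArg (fun w : SU2 => F V * su2Char 1 w) ?_
      -- the merged word is the open strip of length `R' + 1`
      simp only [sheetLine_succ, Nat.cast_succ, mul_inv_rev, mul_assoc]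

/-- **A full row of the sheet integrates to `2^{−Lᵢ} χ(H_b) χ(H_{b+1})`** against every continuous spectator not reading
the `j`-links of the row (`Lᵢ − 1` mergings, then the handle identity `∫ χ(αgβg⁻¹) dg = ½ χ(α)χ(β)`
(`integral_pi_su2_handle`) on `v(0, b)`, and `χ(g⁻¹) = χ(g)`). -/
theorem integral_mul_prod_sheetRow (hij : i < j) (y : RectTorusSite Ls) (b : ZMod (Ls j)) (F : RectGaugeConfig Ls SU2 → ℝ)
    (hFc : Continuous F) (hF : ∀ (a : ZMod (Ls i)) (V : RectGaugeConfig Ls SU2) (g : SU2),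
      F (update V (sheetSite Ls i j y a b, j) g) = F V) :
    ∫ V, F V * ∏ a ∈ range (Ls i), sheetPlaqChar Ls i j y (a : ZMod (Ls i)) b V
        ∂(Measure.pi fun _ : RectEdge Ls => haarProbability SU2) =
      ((2 : ℝ) ^ (Ls i))⁻¹ * ∫ V, F V * (su2Char 1 (sheetLine Ls i j y b (Ls i) V) *
          su2Char 1 (sheetLine Ls i j y (b + 1) (Ls i) V)) ∂(Measure.pi fun _ : RectEdge Ls => haarProbability SU2) := by
  have hn : 1 ≤ Ls i := NeZero.one_le
  rw [integral_mul_prod_sheetRow_open Ls hij y b (Ls i) hn le_rfl F hFc (fun a _ _ V g => hF _ V g),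
    ZMod.natCast_self]
  -- the handle on `c = v(0, b)`
  have h := integral_pi_su2_handle (ι := RectEdge Ls) (sheetSite Ls i j y 0 b, j)
    (fun V => sheetLine Ls i j y b (Ls i) V) (fun V => (sheetLine Ls i j y (b + 1) (Ls i) V)⁻¹) F
    (fun V g => sheetLine_update_jlink Ls hij y b _ V _ g)
    (fun V g => by rw [sheetLine_update_jlink Ls hij])
    (fun V g => hF 0 V g) (continuous_sheetLine Ls y b _) (continuous_sheetLine Ls y (b + 1) _).inv hFc 1
  rw [show ((1 : ℕ) : ℝ) + 1 = 2 by norm_num] at h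
  have hpt : ∀ V : RectGaugeConfig Ls SU2,
      F V * su2Char 1 (sheetLine Ls i j y b (Ls i) V * V (sheetSite Ls i j y 0 b, j) *
          (sheetLine Ls i j y (b + 1) (Ls i) V)⁻¹ * (V (sheetSite Ls i j y 0 b, j))⁻¹) =
        su2Char 1 (sheetLine Ls i j y b (Ls i) V * V (sheetSite Ls i j y 0 b, j) *
          (sheetLine Ls i j y (b + 1) (Ls i) V)⁻¹ * (V (sheetSite Ls i j y 0 b, j))⁻¹) * F V := fun V => mul_comm _ _
  simp_rw [hpt]
  erw [h]
  rw [← mul_assoc, ← mul_inv, ← pow_succ, Nat.sub_add_cancel hn]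
  refine congrArg (HMul.hMul _) (integral_congr_ae (ae_of_all _ fun V => ?_))
  show su2Char 1 (sheetLine Ls i j y b (Ls i) V) * su2Char 1 (sheetLine Ls i j y (b + 1) (Ls i) V)⁻¹ * F V = _
  rw [su2Char_of_inv]
  ring

/-- **All rows.**  For `s ⊆ ℤ/Lⱼ` and a continuous spectator `Φ` not reading the `j`-links of the rows in `s`,
`∫ Φ · ∏_{b ∈ s} ∏_a χ(U_{(a,b)}) = 2^{−Lᵢ|s|} ∫ Φ · ∏_{b ∈ s} χ(H_b) χ(H_{b+1})` (row by row). -/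
theorem integral_mul_prod_sheetRows (hij : i < j) (y : RectTorusSite Ls) (s : Finset (ZMod (Ls j))) :
    ∀ (Φ : RectGaugeConfig Ls SU2 → ℝ), Continuous Φ →
      (∀ b ∈ s, ∀ (a : ZMod (Ls i)) (V : RectGaugeConfig Ls SU2) (g : SU2),
        Φ (update V (sheetSite Ls i j y a b, j) g) = Φ V) →
      ∫ V, Φ V * ∏ b ∈ s, ∏ a ∈ range (Ls i), sheetPlaqChar Ls i j y (a : ZMod (Ls i)) b V
          ∂(Measure.pi fun _ : RectEdge Ls => haarProbability SU2) =
        ((2 : ℝ) ^ (Ls i * s.card))⁻¹ *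
          ∫ V, Φ V * ∏ b ∈ s, (su2Char 1 (sheetLine Ls i j y b (Ls i) V) *
              su2Char 1 (sheetLine Ls i j y (b + 1) (Ls i) V)) ∂(Measure.pi fun _ : RectEdge Ls => haarProbability SU2) := by
  classical
  refine Finset.induction_on s ?_ ?_
  · intro Φ _ _
    simp
  · intro b s hb ih Φ hΦc hΦ
    -- the rows of `s` first (the new row is a spectator), then the new row (the lines of `s` are spectators)
    have hsplit : ∀ V : RectGaugeConfig Ls SU2,
        Φ V * ∏ b' ∈ insert b s, ∏ a ∈ range (Ls i), sheetPlaqChar Ls i j y (a : ZMod (Ls i)) b' V =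
          (Φ V * ∏ a ∈ range (Ls i), sheetPlaqChar Ls i j y (a : ZMod (Ls i)) b V) *
            ∏ b' ∈ s, ∏ a ∈ range (Ls i), sheetPlaqChar Ls i j y (a : ZMod (Ls i)) b' V := by
      intro V
      rw [Finset.prod_insert hb]
      ring
    simp_rw [hsplit]
    rw [ih (fun V => Φ V * ∏ a ∈ range (Ls i), sheetPlaqChar Ls i j y (a : ZMod (Ls i)) b V)
      (hΦc.mul (continuous_finsetProd _ fun a _ => continuous_sheetPlaqChar Ls y _ b))
      (fun b' hb' a' V g => by
        rw [hΦ b' (Finset.mem_insert_of_mem hb')]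
        exact congrArg (HMul.hMul (Φ V)) (Finset.prod_congr rfl fun a _ =>
          sheetPlaqChar_update_jlink_of_ne Ls hij y _ _ (by rintro rfl; exact hb hb') V g))]
    have hsplit' : ∀ V : RectGaugeConfig Ls SU2,
        (Φ V * ∏ a ∈ range (Ls i), sheetPlaqChar Ls i j y (a : ZMod (Ls i)) b V) *
            ∏ b' ∈ s, (su2Char 1 (sheetLine Ls i j y b' (Ls i) V) * su2Char 1 (sheetLine Ls i j y (b' + 1) (Ls i) V)) =
          (Φ V * ∏ b' ∈ s, (su2Char 1 (sheetLine Ls i j y b' (Ls i) V) *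
              su2Char 1 (sheetLine Ls i j y (b' + 1) (Ls i) V))) *
            ∏ a ∈ range (Ls i), sheetPlaqChar Ls i j y (a : ZMod (Ls i)) b V := by
      intro V
      ring
    simp_rw [hsplit']
    rw [integral_mul_prod_sheetRow Ls hij y b
      (fun V => Φ V * ∏ b' ∈ s, (su2Char 1 (sheetLine Ls i j y b' (Ls i) V) *
        su2Char 1 (sheetLine Ls i j y (b' + 1) (Ls i) V)))
      (hΦc.mul (continuous_finsetProd _ fun b' _ =>
        (continuous_su2Char_sheetLine Ls y b' _).mul (continuous_su2Char_sheetLine Ls y (b' + 1) _)))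
      (fun a V g => by
        rw [hΦ b (Finset.mem_insert_self b s)]
        simp only [sheetLine_update_jlink Ls hij]),
      Finset.card_insert_of_notMem hb, ← mul_assoc, ← mul_inv, ← pow_add,
      show Ls i * s.card + Ls i = Ls i * (s.card + 1) by ring]
    refine congrArg (HMul.hMul _) (integral_congr_ae (ae_of_all _ fun V => ?_))
    show _ = Φ V * ∏ b' ∈ insert b s, (su2Char 1 (sheetLine Ls i j y b' (Ls i) V) *
      su2Char 1 (sheetLine Ls i j y (b' + 1) (Ls i) V))
    rw [Finset.prod_insert hb]
    ring

/-- **One Polyakov line integrates its squared character to one**: for a continuous spectator `Ψ` not reading the link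
`h(0, b)`, `∫ Ψ · χ(H_b)² = ∫ Ψ` (translate the Haar variable `h(0, b)` by the rest of the line; `∫ χ² dHaar = 1`,
`LatticeQCDFlow.Scoring.integral_su2Character_sq`). -/
theorem integral_mul_lineSq (hij : i < j) (y : RectTorusSite Ls) (b : ZMod (Ls j)) (Ψ : RectGaugeConfig Ls SU2 → ℝ)
    (hΨc : Continuous Ψ) (hΨ : ∀ (V : RectGaugeConfig Ls SU2) (g : SU2), Ψ (update V (sheetSite Ls i j y 0 b, i) g) = Ψ V) :
    ∫ V, Ψ V * su2Char 1 (sheetLine Ls i j y b (Ls i) V) ^ 2 ∂(Measure.pi fun _ : RectEdge Ls => haarProbability SU2) =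
      ∫ V, Ψ V ∂(Measure.pi fun _ : RectEdge Ls => haarProbability SU2) := by
  obtain ⟨n, hn⟩ : ∃ n, Ls i = n + 1 := Nat.exists_eq_succ_of_ne_zero (NeZero.ne _)
  have hhead := sheetLine_succ_eq_head_mul Ls (i := i) (j := j) y b n
  rw [← hn] at hhead
  have hint : Integrable (fun V : RectGaugeConfig Ls SU2 => Ψ V * su2Char 1 (sheetLine Ls i j y b (Ls i) V) ^ 2)
      (Measure.pi fun _ : RectEdge Ls => haarProbability SU2) :=
    integrable_pi_su2_of_continuous (hΨc.mul ((continuous_su2Char_sheetLine Ls y b _).pow 2))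
  rw [integral_pi_eq_integral_update (haarProbability SU2) (sheetSite Ls i j y 0 b, i) hint]
  refine integral_congr_ae (ae_of_all _ fun V => ?_)
  beta_reduce
  -- through the updated link the line reads `g · K(V)` with `K` not reading the link
  have hK : ∀ g : SU2, sheetLine Ls i j y b (Ls i) (update V (sheetSite Ls i j y 0 b, i) g) =
      g * ((List.range n).map fun a : ℕ => V (sheetSite Ls i j y ((a + 1 : ℕ) : ZMod (Ls i)) b, i)).prod := by
    intro g
    rw [hhead, update_self]
    congr 1
    refine congrArg List.prod (List.map_congr_left fun a ha => update_of_ne ?_ _ _)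
    intro h
    have e := ((sheetSite_eq_iff Ls hij y).1 (congrArg Prod.fst h)).1
    rw [← Nat.cast_zero] at e
    exact natCast_zmod_ne_of_lt (by have := List.mem_range.1 ha; omega) (by omega)
      (by omega) e
  have hfun : (fun g : SU2 => Ψ (update V (sheetSite Ls i j y 0 b, i) g) *
      su2Char 1 (sheetLine Ls i j y b (Ls i) (update V (sheetSite Ls i j y 0 b, i) g)) ^ 2) =
      fun g : SU2 => Ψ V * (fun x : SU2 => su2Char 1 x ^ 2)
        (g * ((List.range n).map fun a : ℕ => V (sheetSite Ls i j y ((a + 1 : ℕ) : ZMod (Ls i)) b, i)).prod) := by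
    funext g
    rw [hΨ, hK g]
  rw [hfun, integral_const_mul, integral_mul_right_eq_self (fun x : SU2 => su2Char 1 x ^ 2)]
  have hsq : ∫ x : SU2, su2Char 1 x ^ 2 ∂haarProbability SU2 = 1 := integral_su2Character_sq 1
  rw [hsq, mul_one]

/-- **All Polyakov lines**: `∫ Φ · ∏_{b ∈ s} χ(H_b)² = ∫ Φ` for a continuous spectator not reading the links `h(0, b)`,
`b ∈ s` (line by line). -/
theorem integral_mul_prod_lineSq (hij : i < j) (y : RectTorusSite Ls) (s : Finset (ZMod (Ls j))) :
    ∀ (Φ : RectGaugeConfig Ls SU2 → ℝ), Continuous Φ →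
      (∀ b ∈ s, ∀ (V : RectGaugeConfig Ls SU2) (g : SU2), Φ (update V (sheetSite Ls i j y 0 b, i) g) = Φ V) →
      ∫ V, Φ V * ∏ b ∈ s, su2Char 1 (sheetLine Ls i j y b (Ls i) V) ^ 2
          ∂(Measure.pi fun _ : RectEdge Ls => haarProbability SU2) =
        ∫ V, Φ V ∂(Measure.pi fun _ : RectEdge Ls => haarProbability SU2) := by
  classical
  refine Finset.induction_on s ?_ ?_
  · intro Φ _ _
    simp
  · intro b s hb ih Φ hΦc hΦ
    have hsplit : ∀ V : RectGaugeConfig Ls SU2,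
        Φ V * ∏ b' ∈ insert b s, su2Char 1 (sheetLine Ls i j y b' (Ls i) V) ^ 2 =
          (Φ V * ∏ b' ∈ s, su2Char 1 (sheetLine Ls i j y b' (Ls i) V) ^ 2) *
            su2Char 1 (sheetLine Ls i j y b (Ls i) V) ^ 2 := by
      intro V
      rw [Finset.prod_insert hb]
      ring
    simp_rw [hsplit]
    rw [integral_mul_lineSq Ls hij y b (fun V => Φ V * ∏ b' ∈ s, su2Char 1 (sheetLine Ls i j y b' (Ls i) V) ^ 2)
      (hΦc.mul (continuous_finsetProd _ fun b' _ => (continuous_su2Char_sheetLine Ls y b' _).pow 2))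
      (fun V g => by
        rw [hΦ b (Finset.mem_insert_self b s)]
        exact congrArg (HMul.hMul (Φ V)) (Finset.prod_congr rfl fun b' hb' => by
          rw [sheetLine_update_ilink_of_ne Ls hij y (fun h : b = b' => hb (h ▸ hb')) _ V])),
      ih Φ hΦc (fun b' hb' V g => hΦ b' (Finset.mem_insert_of_mem hb') V g)]

end Summit.Ventures.YMGap.Census

end
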